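import Mathlib
import Literature.Analysis.FluidPDE.SuitableWeak
import Literature.Analysis.FluidPDE.SpaceTimeRescaling
import Literature.Analysis.FluidPDE.WeakGradientSlicing
import Literature.Analysis.FluidPDE.NSSuitableESSProofs
import Literature.Analysis.FunctionSpaces.SobolevDomainProofs
import Literature.Analysis.FunctionSpaces.SobolevDifferenceQuotients
import Summits.NavierStokesRegularity.NavierStokesRegularity.Theorems.TypeILiouvilleTypeIliouvilleNoTypeIIPowerGaugeSteady
import Summits.NavierStokesRegularity.NavierStokesRegularity.Theorems.EulerZoomLiouvillePowerGaugeEulerLiouvilleTimePeriodicTools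
import Summits.NavierStokesRegularity.NavierStokesRegularity.Theorems.EulerZoomLiouvillePowerGaugeEulerLiouvillePastTimePeriodic
import Summits.NavierStokesRegularity.NavierStokesRegularity.Theorems.EulerZoomLiouvillePowerGaugeEulerLiouvillePastSymmetric
import HarnessLib

/-!
# FRAME-STEADY PAST MEMBERS WITH A SUB-CRITICALLY ESCAPING FRAME ARE TRIVIAL
# (line `galilean-frames`, the confined half of stub F1 `stub_frameSteady`; crux = stmt-NavierStokesRegularity-19832)

Route `EulerZoomLiouville` (NavierStokesRegularity); width seat ns-ezl-w6 g2 (LEAD ns-typeII-p2 g12; line `galilean-frames` of ns-idea-11 g6, 2026-08-28).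
A member of Seregin's power-gauged ancient Euler class (`0 < ρ < 1`) whose past is FRAME-STEADY — `u(τ, y) = U(y − ξ(τ)) + η(τ)` for `τ < T₁ ≤ 0`, ONE
profile carried along an ARBITRARY frame path `ξ` (no regularity) with an arbitrary uniform background `η` — and whose frame escapes SUB-CRITICALLY,
`‖ξ(τ)‖ ≤ K (1 + |τ|)^β` with `β(1 − ρ) < 1`, vanishes a.e. on the slab (`FrameSteady.ae_eq_zero_of_gauge_of_pastFrameSteady_confined`).  Every
constant-velocity TRAVELING WAVE (`β = 1`) and every mildly accelerating frame is covered, with NO use of the Euler equation: (1) for a.e. `τ < T₁` the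
slice `H(τ)` is a weak derivative of the slice `u(τ)` (`HasWeakSpatialGradientOn.ae_hasWeakFDerivOn_slice`), all slices are translates of one another up to
constants, so `H(τ) = G₀(· − ξ(τ))` a.e. for ONE field `G₀` (`HasWeakFDerivOn.comp_add`, uniqueness `HasWeakFDerivOn.unique_holds`); (2) E-GAUGE PACKING IN
CONTINUOUS TIME: on the window `(T₁ − L, T₁)` the frame stays in `B_{a/2}`, `a ≍ (L + |T₁| + 1)^β`, so `L ∫_{B_{a/2}}|G₀|² ≤ ∫∫_{Q_a(0)}|H|² ≤ c a^{1−ρ}`,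
i.e. `∫_{B_{a/2}}|G₀|² ≲ L^{β(1−ρ) − 1} → 0`: `G₀ = 0`, `H = 0` a.e. below `T₁`; (3) a.e. slice below `T₁` is a.e. constant
(`PowerGaugeSteady.ae_slice_const_of_weakGradient_ae_zero`), has zero energy by the `A`-gauge (`PastPeriodic.lintegral_slice_eq_zero_of_ae_const_of_gaugeA`),
and a member quiescent on a past sub-slab is trivial (`PastSymmetric.ae_eq_zero_of_gauge_of_pastSlicesZero`).  What remains of F1 is the FAST-FRAME residue
`‖ξ(τ)‖ ≳ |τ|^{1/(1−ρ)}` (the card's lever L2, Euler equation — not here).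
WHAT THIS IS NOT: not NS, not E — a CLOSED-FORM stratum of the crux CLASS on the MODEL lattice (`--supports` stmt-19832); 19832 OPEN. [folklore]
-/

noncomputable section

set_option linter.dupNamespace false -- flat `Theorems/<Route><Decl>…` files share the crux namespace `Summit.<S>.<S>.…`

open MeasureTheory Set Filter Topology Metric Function TopologicalSpace
open scoped ENNReal NNReal

namespace Summit.NavierStokesRegularity.NavierStokesRegularity.Theorems.PowerGaugeEulerLiouville

open Literature.Analysis Literature.Analysis.FunctionSpaces Literature.Analysis.FluidPDE

namespace FrameSteady

variable {u : ℝ → EuclideanSpace ℝ (Fin 3) → EuclideanSpace ℝ (Fin 3)}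
  {H : ℝ → EuclideanSpace ℝ (Fin 3) → EuclideanSpace ℝ (Fin 3) →L[ℝ] EuclideanSpace ℝ (Fin 3)}
  {T₁ : ℝ} {U : EuclideanSpace ℝ (Fin 3) → EuclideanSpace ℝ (Fin 3)} {ξ η : ℝ → EuclideanSpace ℝ (Fin 3)}

/-! ## (0) From a.e. slices to the slab -/

/-- **A field whose a.e. slice below `T` vanishes a.e. vanishes a.e. on `(−∞, T) × ℝ³`** (measurable modification + `Measure.ae_prod_iff_ae_ae`). [folklore] -/
theorem ae_zero_of_ae_slice {β : Type*} [NormedAddCommGroup β] {G : ℝ → EuclideanSpace ℝ (Fin 3) → β} {T : ℝ}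
    (hmeas : AEStronglyMeasurable (uncurry G) (volume.restrict (Iio T ×ˢ (univ : Set (EuclideanSpace ℝ (Fin 3))))))
    (hslice : ∀ᵐ t ∂(volume.restrict (Iio T)), G t =ᵐ[volume] 0) :
    ∀ᵐ z ∂(volume.restrict (Iio T ×ˢ (univ : Set (EuclideanSpace ℝ (Fin 3))))), G z.1 z.2 = 0 := by
  have hprod : (volume.restrict (Iio T ×ˢ (univ : Set (EuclideanSpace ℝ (Fin 3)))) : Measure (ℝ × EuclideanSpace ℝ (Fin 3))) =
      ((volume : Measure ℝ).restrict (Iio T)).prod ((volume : Measure (EuclideanSpace ℝ (Fin 3))).restrict univ) := by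
    rw [Measure.prod_restrict, ← Measure.volume_eq_prod]
  obtain ⟨g, hg, hug⟩ := hmeas
  rw [hprod] at hug ⊢
  have hgslice : ∀ᵐ t ∂((volume : Measure ℝ).restrict (Iio T)),
      ∀ᵐ x ∂((volume : Measure (EuclideanSpace ℝ (Fin 3))).restrict univ), g (t, x) = 0 := by
    have h1 : ∀ᵐ t ∂((volume : Measure ℝ).restrict (Iio T)), (fun x => uncurry G (t, x))
        =ᵐ[(volume : Measure (EuclideanSpace ℝ (Fin 3))).restrict univ] fun x => g (t, x) :=
      Measure.ae_ae_eq_curry_of_prod hug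
    filter_upwards [hslice, h1] with t ht h1t
    rw [Measure.restrict_univ] at h1t ⊢
    filter_upwards [ht, h1t] with x hx h1x
    rw [← h1x]
    simpa using hx
  have hgae : ∀ᵐ z ∂((volume : Measure ℝ).restrict (Iio T)).prod ((volume : Measure (EuclideanSpace ℝ (Fin 3))).restrict univ), g z = 0 :=
    (Measure.ae_prod_iff_ae_ae (hg.measurableSet_eq_fun stronglyMeasurable_const)).2 hgslice
  filter_upwards [hgae, hug] with z hz huz
  show uncurry G z = 0
  rw [huz]; exact hz

/-! ## (1) All slices of the weak gradient are translates of one field -/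

/-- **For a.e. `τ < T₁` the slice `H(τ)` is a weak derivative of the slice `u(τ)` on `ℝ³`** (`HasWeakSpatialGradientOn.ae_hasWeakFDerivOn_slice` on the finite
slabs `(−M, T₁) × ℝ³`, exhaustion). [folklore] -/
theorem ae_hasWeakFDerivOn_slice_past
    (hH : HasWeakSpatialGradientOn (slab (EuclideanSpace ℝ (Fin 3)) (Iio 0) isOpen_Iio) u H) (hT₁ : T₁ ≤ 0) :
    ∀ᵐ τ ∂(volume.restrict (Iio T₁)), HasWeakFDerivOn (⊤ : Opens (EuclideanSpace ℝ (Fin 3))) volume (u τ) (H τ) := by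
  have hM : ∀ M : ℕ, ∀ᵐ τ ∂(volume.restrict (Ioo (-(M : ℝ)) T₁)),
      HasWeakFDerivOn (⊤ : Opens (EuclideanSpace ℝ (Fin 3))) volume (u τ) (H τ) := by
    intro M
    have h1 : HasWeakSpatialGradientOn (⟨Ioo (-(M : ℝ)) T₁ ×ˢ ((⊤ : Opens (EuclideanSpace ℝ (Fin 3))) : Set (EuclideanSpace ℝ (Fin 3))),
        isOpen_Ioo.prod (⊤ : Opens (EuclideanSpace ℝ (Fin 3))).isOpen⟩ : Opens (ℝ × EuclideanSpace ℝ (Fin 3))) u H := by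
      refine hH.mono (SetLike.coe_subset_coe.1 fun z hz => ?_)
      rw [SetLike.mem_coe, mem_slab]
      exact lt_of_lt_of_le (mem_prod.1 hz).1.2 hT₁
    exact h1.ae_hasWeakFDerivOn_slice
  have hU : Iio T₁ = ⋃ M : ℕ, Ioo (-(M : ℝ)) T₁ := by
    ext τ
    simp only [mem_Iio, mem_iUnion, mem_Ioo]
    constructor
    · intro h
      obtain ⟨M, hM⟩ := exists_nat_gt (-τ)
      exact ⟨M, by linarith, h⟩
    · rintro ⟨M, -, h⟩; exact h
  rw [hU, ae_restrict_iUnion_iff]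
  exact hM

/-- **ONE FIELD CARRIES EVERY SLICE.**  If `u(τ, ·) = U(· − ξ(τ)) + η(τ)` for `τ < T₁ ≤ 0` and `H` is a weak spatial gradient of `u` on the slab, there is a
field `G₀` with `H(τ, ·) = G₀(· − ξ(τ))` a.e., for a.e. `τ < T₁` (two good slices are translates of each other up to a constant: `HasWeakFDerivOn.comp_add`,
constants have weak derivative `0`, uniqueness `HasWeakFDerivOn.unique_holds`). [folklore] -/
theorem exists_profileGradient
    (hH : HasWeakSpatialGradientOn (slab (EuclideanSpace ℝ (Fin 3)) (Iio 0) isOpen_Iio) u H) (hT₁ : T₁ ≤ 0)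
    (hu : ∀ τ : ℝ, τ < T₁ → u τ = fun y => U (y - ξ τ) + η τ) :
    ∃ G₀ : EuclideanSpace ℝ (Fin 3) → EuclideanSpace ℝ (Fin 3) →L[ℝ] EuclideanSpace ℝ (Fin 3),
      ∀ᵐ τ ∂(volume.restrict (Iio T₁)), H τ =ᵐ[volume] fun y => G₀ (y - ξ τ) := by
  have hgood := ae_hasWeakFDerivOn_slice_past hH hT₁
  -- a good slice `τ₀`
  have hne : (ae (volume.restrict (Iio T₁))).NeBot := by
    rw [ae_neBot, Ne, Measure.restrict_eq_zero, Real.volume_Iio]; exact ENNReal.top_ne_zero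
  obtain ⟨τ₀, hτ₀, hτ₀T⟩ := (hgood.and (ae_restrict_mem measurableSet_Iio)).exists
  refine ⟨fun y => H τ₀ (y + ξ τ₀), ?_⟩
  filter_upwards [hgood, ae_restrict_mem measurableSet_Iio] with τ hτ hτT
  -- `u τ = u τ₀ (· + δ) + κ`, `δ = ξ τ₀ − ξ τ`, `κ = η τ − η τ₀`
  have hrel : u τ = fun y => u τ₀ (y + (ξ τ₀ - ξ τ)) + (η τ - η τ₀) := by
    rw [hu τ hτT, hu τ₀ hτ₀T]
    funext y
    simp only
    rw [show y + (ξ τ₀ - ξ τ) - ξ τ₀ = y - ξ τ by abel]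
    abel
  have h1 : HasWeakFDerivOn (⊤ : Opens (EuclideanSpace ℝ (Fin 3))) volume (fun y => u τ₀ (y + (ξ τ₀ - ξ τ)))
      (fun y => H τ₀ (y + (ξ τ₀ - ξ τ))) :=
    hτ₀.comp_add volume fun y _ => mem_univ _
  have hc : HasWeakFDerivOn (⊤ : Opens (EuclideanSpace ℝ (Fin 3))) volume (fun _ : EuclideanSpace ℝ (Fin 3) => -(η τ - η τ₀))
      (fderiv ℝ fun _ : EuclideanSpace ℝ (Fin 3) => -(η τ - η τ₀)) :=
    HasWeakFDerivOn.of_contDiff_holds ⊤ volume contDiff_const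
  have h2 := h1.sub hc
  have e1 : ((fun y => u τ₀ (y + (ξ τ₀ - ξ τ))) - fun _ : EuclideanSpace ℝ (Fin 3) => -(η τ - η τ₀)) = u τ := by
    rw [hrel]; funext y; simp only [Pi.sub_apply]; abel
  have e2 : ((fun y => H τ₀ (y + (ξ τ₀ - ξ τ))) - fderiv ℝ fun _ : EuclideanSpace ℝ (Fin 3) => -(η τ - η τ₀)) =
      fun y => H τ₀ (y + (ξ τ₀ - ξ τ)) := by
    funext y; simp
  rw [e1, e2] at h2
  have h3 := HasWeakFDerivOn.unique_holds hτ h2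
  rw [Opens.coe_top, Measure.restrict_univ] at h3
  filter_upwards [h3] with y hy
  rw [hy, show y + (ξ τ₀ - ξ τ) = y - ξ τ + ξ τ₀ by abel]

/-! ## (2) E-gauge packing in continuous time -/

/-- **Translating a ball integral under the frame**: if `‖x‖ ≤ a/2` then `∫_{B_{a/2}} g ≤ ∫_{B_a} g(· − x)`. [folklore] -/
theorem setLIntegral_ball_half_le_translate (g : EuclideanSpace ℝ (Fin 3) → ℝ≥0∞) {a : ℝ} {x : EuclideanSpace ℝ (Fin 3)} (hx : ‖x‖ ≤ a / 2) :
    ∫⁻ y in ball (0 : EuclideanSpace ℝ (Fin 3)) (a / 2), g y ≤ ∫⁻ y in ball (0 : EuclideanSpace ℝ (Fin 3)) a, g (y - x) := by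
  have hpre : (fun y : EuclideanSpace ℝ (Fin 3) => -x + (1 : ℝ) • y) ⁻¹' ball (-x) a = ball 0 a := by
    rw [space_affine_preimage_ball one_pos]; simp
  have h1 : ∫⁻ y in ball (0 : EuclideanSpace ℝ (Fin 3)) a, g (y - x) = ∫⁻ y in ball (-x) a, g y := by
    have e : (fun y : EuclideanSpace ℝ (Fin 3) => g (y - x)) = fun y => g (-x + (1 : ℝ) • y) := by
      funext y; rw [one_smul, neg_add_eq_sub]
    rw [e, ← hpre, setLIntegral_preimage_comp_space_affine one_pos (-x) g (ball (-x) a), finrank_euclideanSpace_fin, one_pow,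
      inv_one, ENNReal.ofReal_one, one_mul]
  rw [h1]
  refine lintegral_mono_set fun y hy => ?_
  rw [mem_ball, dist_eq_norm] at hy ⊢
  have : ‖y - -x‖ ≤ ‖y‖ + ‖x‖ := by rw [sub_neg_eq_add]; exact norm_add_le _ _
  rw [sub_zero] at hy
  linarith

/-- **THE PACKING BOUND.**  If `H(τ) = G₀(· − ξ(τ))` a.e. for a.e. `τ < T₁ ≤ 0`, the frame stays in `B_{a/2}` on the window `(T₁ − L, T₁)` (`L > 0`),
`L + |T₁| ≤ a`, `1 ≤ a`, and `a^ρ E(H; Q_a(0)) ≤ c`, then `L · ∫_{B_{a/2}} |G₀|²_F ≤ c a^{1−ρ}` (Tonelli on the window, the translated balls, the gauge). [folklore] -/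
theorem window_mul_le_of_gaugeE
    (hH : HasWeakSpatialGradientOn (slab (EuclideanSpace ℝ (Fin 3)) (Iio 0) isOpen_Iio) u H) (hT₁ : T₁ ≤ 0)
    {G₀ : EuclideanSpace ℝ (Fin 3) → EuclideanSpace ℝ (Fin 3) →L[ℝ] EuclideanSpace ℝ (Fin 3)}
    (hrep : ∀ᵐ τ ∂(volume.restrict (Iio T₁)), H τ =ᵐ[volume] fun y => G₀ (y - ξ τ))
    {L a : ℝ} (ha1 : 1 ≤ a) (hLa : L + |T₁| ≤ a) (hξ : ∀ τ : ℝ, T₁ - L < τ → τ < T₁ → ‖ξ τ‖ ≤ a / 2)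
    {ρ : ℝ} {c : ℝ≥0} (hE : ENNReal.ofReal (a ^ ρ) * cknE a (0 : ℝ × EuclideanSpace ℝ (Fin 3)) H ≤ (c : ℝ≥0∞)) :
    ENNReal.ofReal L * ∫⁻ y in ball (0 : EuclideanSpace ℝ (Fin 3)) (a / 2), ENNReal.ofReal (frobeniusNormSq (G₀ y)) ≤
      ENNReal.ofReal ((c : ℝ) * a ^ (1 - ρ)) := by
  have ha0 : 0 < a := by linarith
  set f : ℝ × EuclideanSpace ℝ (Fin 3) → ℝ≥0∞ := fun z => ENNReal.ofReal (frobeniusNormSq (H z.1 z.2)) with hf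
  set I : ℝ≥0∞ := ∫⁻ y in ball (0 : EuclideanSpace ℝ (Fin 3)) (a / 2), ENNReal.ofReal (frobeniusNormSq (G₀ y)) with hI
  -- the window box sits in `Q_a(0)`
  have hwin : Ioo (T₁ - L) T₁ ×ˢ ball (0 : EuclideanSpace ℝ (Fin 3)) a ⊆ Ioo (-(a ^ 2)) 0 ×ˢ ball (0 : EuclideanSpace ℝ (Fin 3)) a := by
    refine Set.prod_mono (fun τ hτ => ⟨?_, lt_of_lt_of_le hτ.2 hT₁⟩) Subset.rfl
    have h1 : a ≤ a ^ 2 := by nlinarith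
    linarith [hτ.1, neg_abs_le T₁]
  have hgauge := TimePeriodic.setLIntegral_window_le_of_gaugeE (H := H) (T := a ^ 2) ha0 le_rfl le_rfl hE
  refine le_trans ?_ ((lintegral_mono_set hwin).trans hgauge)
  -- Tonelli on the window box
  have hmeas : AEMeasurable f ((volume.restrict (Ioo (T₁ - L) T₁)).prod (volume.restrict (ball (0 : EuclideanSpace ℝ (Fin 3)) a))) := by
    have h1 : AEStronglyMeasurable (uncurry H) (volume.restrict (Ioo (T₁ - L) T₁ ×ˢ ball (0 : EuclideanSpace ℝ (Fin 3)) a)) := by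
      have h0 := hH.locallyIntegrableOn_grad.aestronglyMeasurable
      rw [coe_slab] at h0
      exact h0.mono_set (Set.prod_mono (fun τ hτ => lt_of_lt_of_le hτ.2 hT₁) (subset_univ _))
    rw [Measure.volume_eq_prod, ← Measure.prod_restrict] at h1
    exact ((ENNReal.continuous_ofReal.comp LerayHopfProofs.continuous_frobeniusNormSq).comp_aestronglyMeasurable h1).aemeasurable
  rw [Measure.volume_eq_prod, ← Measure.prod_restrict, lintegral_prod _ hmeas]
  -- slice by slice: `I ≤ ∫_{B_a} f(τ, ·)` for a.e. `τ` in the window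
  have hslice : ∀ᵐ τ ∂(volume.restrict (Ioo (T₁ - L) T₁)), I ≤ ∫⁻ y in ball (0 : EuclideanSpace ℝ (Fin 3)) a, f (τ, y) := by
    filter_upwards [ae_restrict_of_ae_restrict_of_subset (fun τ hτ => hτ.2 : Ioo (T₁ - L) T₁ ⊆ Iio T₁) hrep,
      ae_restrict_mem measurableSet_Ioo] with τ hτ hτI
    have e : ∫⁻ y in ball (0 : EuclideanSpace ℝ (Fin 3)) a, f (τ, y) =
        ∫⁻ y in ball (0 : EuclideanSpace ℝ (Fin 3)) a, ENNReal.ofReal (frobeniusNormSq (G₀ (y - ξ τ))) := by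
      refine lintegral_congr_ae (ae_restrict_of_ae ?_)
      filter_upwards [hτ] with y hy
      simp only [hf, hy]
    rw [e]
    exact setLIntegral_ball_half_le_translate (fun y => ENNReal.ofReal (frobeniusNormSq (G₀ y))) (hξ τ hτI.1 hτI.2)
  calc ENNReal.ofReal L * I = ∫⁻ _ in Ioo (T₁ - L) T₁, I := by
        rw [lintegral_const, Measure.restrict_apply_univ, Real.volume_Ioo, show T₁ - (T₁ - L) = L by ring, mul_comm]
    _ ≤ ∫⁻ τ in Ioo (T₁ - L) T₁, ∫⁻ y in ball (0 : EuclideanSpace ℝ (Fin 3)) a, f (τ, y) := lintegral_mono_ae hslice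

/-- **THE PROFILE GRADIENT VANISHES under sub-critical escape** (`0 < ρ < 1`, `‖ξ(τ)‖ ≤ K(1+|τ|)^β` for `τ < T₁`, `β(1−ρ) < 1`): for every `R`,
`∫_{B_R} |G₀|²_F = 0` — windows `L → ∞` with `a = (2K+1)(1 + L + |T₁|)^{max β 1}` give `∫_{B_{a/2}}|G₀|² ≤ c (2K+1)^{1−ρ} (1+L+|T₁|)^{β'(1−ρ)}/L → 0`. [folklore] -/
theorem setLIntegral_profileGradient_eq_zero
    (hH : HasWeakSpatialGradientOn (slab (EuclideanSpace ℝ (Fin 3)) (Iio 0) isOpen_Iio) u H) (hT₁ : T₁ ≤ 0)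
    {G₀ : EuclideanSpace ℝ (Fin 3) → EuclideanSpace ℝ (Fin 3) →L[ℝ] EuclideanSpace ℝ (Fin 3)}
    (hrep : ∀ᵐ τ ∂(volume.restrict (Iio T₁)), H τ =ᵐ[volume] fun y => G₀ (y - ξ τ))
    {ρ : ℝ} (hρ : 0 < ρ) (hρ1 : ρ < 1) {c : ℝ≥0}
    (hE : ∀ a : ℝ, 0 < a → ENNReal.ofReal (a ^ ρ) * cknE a (0 : ℝ × EuclideanSpace ℝ (Fin 3)) H ≤ (c : ℝ≥0∞))
    {K β : ℝ} (hK : 0 ≤ K) (hβρ : β * (1 - ρ) < 1) (hξ : ∀ τ : ℝ, τ < T₁ → ‖ξ τ‖ ≤ K * (1 + |τ|) ^ β) (R : ℝ) :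
    ∫⁻ y in ball (0 : EuclideanSpace ℝ (Fin 3)) R, ENNReal.ofReal (frobeniusNormSq (G₀ y)) = 0 := by
  set g : EuclideanSpace ℝ (Fin 3) → ℝ≥0∞ := fun y => ENNReal.ofReal (frobeniusNormSq (G₀ y)) with hg
  -- enlarge the escape exponent to `β' = max β 1`
  set β' : ℝ := max β 1 with hβ'
  have hβ'1 : 1 ≤ β' := le_max_right _ _
  have hβ'ρ : β' * (1 - ρ) < 1 := by
    rcases le_total β 1 with h | h
    · rw [hβ', max_eq_right h]; linarith
    · rw [hβ', max_eq_left h]; exact hβρ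
  have hξ' : ∀ τ : ℝ, τ < T₁ → ‖ξ τ‖ ≤ K * (1 + |τ|) ^ β' := fun τ hτ =>
    (hξ τ hτ).trans (mul_le_mul_of_nonneg_left (Real.rpow_le_rpow_of_exponent_le (by linarith [abs_nonneg τ]) (le_max_left _ _)) hK)
  -- the bound on the window of length `L ≥ 1`
  set C₀ : ℝ := 1 + |T₁| with hC₀
  have hC₀1 : 1 ≤ C₀ := by rw [hC₀]; linarith [abs_nonneg T₁]
  have key : ∀ L : ℝ, 1 ≤ L → 2 * R ≤ L →
      ∫⁻ y in ball (0 : EuclideanSpace ℝ (Fin 3)) R, g y ≤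
        ENNReal.ofReal ((c : ℝ) * (2 * K + 1) ^ (1 - ρ) * ((L + C₀) ^ (β' * (1 - ρ)) / L)) := by
    intro L hL1 hLR
    have hL : 0 < L := by linarith
    set Λ : ℝ := L + C₀ with hΛ
    have hΛ1 : 1 ≤ Λ := by rw [hΛ]; linarith
    have hΛ0 : 0 < Λ := by linarith
    set a : ℝ := (2 * K + 1) * Λ ^ β' with ha
    have hΛβ : Λ ≤ Λ ^ β' := by
      have := Real.rpow_le_rpow_of_exponent_le hΛ1 hβ'1
      rwa [Real.rpow_one] at this
    have h2K : 1 ≤ 2 * K + 1 := by linarith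
    have haΛ : Λ ^ β' ≤ a := by rw [ha]; exact le_mul_of_one_le_left (by positivity) h2K
    have ha1 : 1 ≤ a := hΛ1.trans (hΛβ.trans haΛ)
    have ha0 : 0 < a := by linarith
    have hLa : L + |T₁| ≤ a := by
      have : L + |T₁| ≤ Λ := by rw [hΛ, hC₀]; linarith
      exact this.trans (hΛβ.trans haΛ)
    -- the frame stays in `B_{a/2}` on the window
    have hfr : ∀ τ : ℝ, T₁ - L < τ → τ < T₁ → ‖ξ τ‖ ≤ a / 2 := by
      intro τ h1 h2
      have hτ : 1 + |τ| ≤ Λ := by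
        rw [hΛ, hC₀]
        have : |τ| ≤ |T₁| + L := by
          rw [abs_le]; constructor <;> linarith [le_abs_self T₁, neg_abs_le T₁]
        linarith
      have h3 : (1 + |τ|) ^ β' ≤ Λ ^ β' := Real.rpow_le_rpow (by linarith [abs_nonneg τ]) hτ (by linarith)
      calc ‖ξ τ‖ ≤ K * (1 + |τ|) ^ β' := hξ' τ h2
        _ ≤ K * Λ ^ β' := mul_le_mul_of_nonneg_left h3 hK
        _ ≤ a / 2 := by rw [ha]; nlinarith [Real.rpow_nonneg hΛ0.le β']
    have hpack := window_mul_le_of_gaugeE hH hT₁ hrep ha1 hLa hfr (hE a ha0)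
    -- `B_R ⊆ B_{a/2}` and divide by `L`
    have hRa : R ≤ a / 2 := by
      have : L ≤ a := le_trans (by linarith [abs_nonneg T₁]) hLa
      linarith
    have h1 : ENNReal.ofReal L * ∫⁻ y in ball (0 : EuclideanSpace ℝ (Fin 3)) R, g y ≤ ENNReal.ofReal ((c : ℝ) * a ^ (1 - ρ)) :=
      le_trans (mul_le_mul' le_rfl (lintegral_mono_set (ball_subset_ball hRa))) hpack
    have hL0' : ENNReal.ofReal L ≠ 0 := (ENNReal.ofReal_pos.2 hL).ne'
    have h2 : ∫⁻ y in ball (0 : EuclideanSpace ℝ (Fin 3)) R, g y ≤ ENNReal.ofReal ((c : ℝ) * a ^ (1 - ρ)) / ENNReal.ofReal L := by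
      rw [ENNReal.le_div_iff_mul_le (Or.inl hL0') (Or.inl ENNReal.ofReal_ne_top), mul_comm]; exact h1
    refine h2.trans ?_
    rw [← ENNReal.ofReal_div_of_pos hL]
    refine ENNReal.ofReal_le_ofReal ?_
    -- `a^{1−ρ} = (2K+1)^{1−ρ} Λ^{β'(1−ρ)}`
    rw [ha, Real.mul_rpow (by linarith) (Real.rpow_nonneg hΛ0.le _), ← Real.rpow_mul hΛ0.le]
    exact le_of_eq (by ring)
  -- the right-hand side tends to `0` along `L = n → ∞`
  have hlim : Tendsto (fun n : ℕ => ENNReal.ofReal ((c : ℝ) * (2 * K + 1) ^ (1 - ρ) * ((((n : ℝ)) + C₀) ^ (β' * (1 - ρ)) / (n : ℝ))))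
      atTop (𝓝 0) := by
    set γ : ℝ := β' * (1 - ρ) with hγ
    have hγ1 : γ < 1 := hβ'ρ
    -- `(n + C₀)^γ / n ≤ 2^γ n^{γ−1}` for `n ≥ C₀`, and `n^{γ−1} → 0`
    have h0 : Tendsto (fun n : ℕ => (2 : ℝ) ^ γ * (n : ℝ) ^ (γ - 1)) atTop (𝓝 0) := by
      have h1 : Tendsto (fun n : ℕ => ((n : ℝ)) ^ (γ - 1)) atTop (𝓝 0) := by
        have := (tendsto_rpow_neg_atTop (by linarith : 0 < 1 - γ)).comp tendsto_natCast_atTop_atTop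
        refine this.congr fun n => ?_
        simp only [Function.comp, neg_sub]
      have h2 := h1.const_mul ((2 : ℝ) ^ γ)
      rwa [mul_zero] at h2
    have hbd : ∀ᶠ n : ℕ in atTop, ((n : ℝ) + C₀) ^ γ / (n : ℝ) ≤ (2 : ℝ) ^ γ * (n : ℝ) ^ (γ - 1) := by
      filter_upwards [eventually_ge_atTop (Nat.ceil C₀)] with n hn
      have hnC : C₀ ≤ n := (Nat.le_ceil C₀).trans (by exact_mod_cast hn)
      have hn0 : (0 : ℝ) < n := by linarith
      have hγ0 : 0 ≤ γ := by rw [hγ]; exact mul_nonneg (by linarith) (by linarith)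
      have h1 : ((n : ℝ) + C₀) ^ γ ≤ (2 * (n : ℝ)) ^ γ := Real.rpow_le_rpow (by linarith) (by linarith) hγ0
      rw [div_le_iff₀ hn0]
      calc ((n : ℝ) + C₀) ^ γ ≤ (2 * (n : ℝ)) ^ γ := h1
        _ = (2 : ℝ) ^ γ * (n : ℝ) ^ (γ - 1) * n := by
          rw [Real.mul_rpow (by norm_num) hn0.le, Real.rpow_sub_one hn0.ne', mul_assoc, div_mul_cancel₀ _ hn0.ne']
    have hnn : ∀ᶠ n : ℕ in atTop, 0 ≤ ((n : ℝ) + C₀) ^ γ / (n : ℝ) :=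
      Eventually.of_forall fun n => div_nonneg (Real.rpow_nonneg (add_nonneg n.cast_nonneg (by linarith)) _) n.cast_nonneg
    have h3 : Tendsto (fun n : ℕ => ((n : ℝ) + C₀) ^ γ / (n : ℝ)) atTop (𝓝 0) :=
      tendsto_of_tendsto_of_tendsto_of_le_of_le' tendsto_const_nhds h0 hnn hbd
    have h4 := h3.const_mul ((c : ℝ) * (2 * K + 1) ^ (1 - ρ))
    rw [mul_zero] at h4
    have h5 := ENNReal.tendsto_ofReal h4
    rwa [ENNReal.ofReal_zero] at h5
  have key' : ∀ᶠ n : ℕ in atTop, ∫⁻ y in ball (0 : EuclideanSpace ℝ (Fin 3)) R, g y ≤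
      ENNReal.ofReal ((c : ℝ) * (2 * K + 1) ^ (1 - ρ) * ((((n : ℝ)) + C₀) ^ (β' * (1 - ρ)) / (n : ℝ))) := by
    filter_upwards [eventually_ge_atTop (max 1 (Nat.ceil (2 * R)))] with n hn
    have hn1 : (1 : ℝ) ≤ n := by exact_mod_cast (le_max_left _ _).trans hn
    have hnR : 2 * R ≤ n := (Nat.le_ceil (2 * R)).trans (by exact_mod_cast (le_max_right _ _).trans hn)
    exact key n hn1 hnR
  exact le_antisymm (le_of_tendsto_of_tendsto tendsto_const_nhds hlim key') bot_le

/-! ## (3) The stratum -/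

/-- **FRAME-STEADY PAST MEMBERS WITH A SUB-CRITICALLY ESCAPING FRAME ARE TRIVIAL** (`0 < ρ < 1`).  Let `(u, p)` be a suitable weak Euler pair on
`(−∞,0) × ℝ³` with weak spatial gradient `H` in Seregin's class `a^{2ρ}A(a) + a^{ρ}E(a) + a^{2ρ}D(a) ≤ c` (all `a > 0`); suppose `u(τ, ·) = U(· − ξ(τ)) + η(τ)`
for all `τ < T₁ ≤ 0` with an arbitrary profile `U`, background `η` and frame path `ξ` obeying `‖ξ(τ)‖ ≤ K(1 + |τ|)^β`, `β(1 − ρ) < 1` (every traveling wave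
`ξ(τ) = τ b`: `β = 1`).  Then `u = 0` a.e. on the slab. [folklore] -/
theorem ae_eq_zero_of_gauge_of_pastFrameSteady_confined {ρ : ℝ} (hρ : 0 < ρ) (hρ1 : ρ < 1)
    {p : ℝ → EuclideanSpace ℝ (Fin 3) → ℝ} {c : ℝ≥0}
    (hsw : IsSuitableWeakSolutionOn (slab (EuclideanSpace ℝ (Fin 3)) (Iio 0) isOpen_Iio) 0 0 u p)
    (hH : HasWeakSpatialGradientOn (slab (EuclideanSpace ℝ (Fin 3)) (Iio 0) isOpen_Iio) u H)
    (hc : ∀ a : ℝ, 0 < a → ENNReal.ofReal (a ^ (2 * ρ)) * cknA a (0 : ℝ × EuclideanSpace ℝ (Fin 3)) u +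
        ENNReal.ofReal (a ^ ρ) * cknE a (0 : ℝ × EuclideanSpace ℝ (Fin 3)) H +
        ENNReal.ofReal (a ^ (2 * ρ)) * cknD a (0 : ℝ × EuclideanSpace ℝ (Fin 3)) p ≤ (c : ℝ≥0∞))
    (hT₁ : T₁ ≤ 0) (hu : ∀ τ : ℝ, τ < T₁ → u τ = fun y => U (y - ξ τ) + η τ)
    {K β : ℝ} (hK : 0 ≤ K) (hβρ : β * (1 - ρ) < 1) (hξ : ∀ τ : ℝ, τ < T₁ → ‖ξ τ‖ ≤ K * (1 + |τ|) ^ β) :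
    uncurry u =ᵐ[volume.restrict (Iio (0 : ℝ) ×ˢ (univ : Set (EuclideanSpace ℝ (Fin 3))))] 0 := by
  have hE : ∀ a : ℝ, 0 < a → ENNReal.ofReal (a ^ ρ) * cknE a (0 : ℝ × EuclideanSpace ℝ (Fin 3)) H ≤ (c : ℝ≥0∞) :=
    fun a ha => le_trans (le_trans le_add_self le_self_add) (hc a ha)
  have hA : ∀ a : ℝ, 0 < a → ENNReal.ofReal (a ^ (2 * ρ)) * cknA a (0 : ℝ × EuclideanSpace ℝ (Fin 3)) u ≤ (c : ℝ≥0∞) :=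
    fun a ha => le_trans (le_trans le_self_add le_self_add) (hc a ha)
  -- (1) one field carries every slice; (2) it vanishes
  obtain ⟨G₀, hrep⟩ := exists_profileGradient hH hT₁ hu
  have hG0 : G₀ =ᵐ[volume] 0 := by
    have hball : ∀ n : ℕ, ∀ᵐ y ∂(volume.restrict (ball (0 : EuclideanSpace ℝ (Fin 3)) (n : ℝ))), G₀ y = 0 := by
      intro n
      have hm : AEMeasurable (fun y => ENNReal.ofReal (frobeniusNormSq (G₀ y))) (volume.restrict (ball (0 : EuclideanSpace ℝ (Fin 3)) (n : ℝ))) := by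
        -- `G₀` is a.e. a translate of a slice of `H`, hence a.e.-strongly measurable
        have hne : (ae (volume.restrict (Iio T₁))).NeBot := by
          rw [ae_neBot, Ne, Measure.restrict_eq_zero, Real.volume_Iio]; exact ENNReal.top_ne_zero
        obtain ⟨τ, hτ, hτd⟩ := (hrep.and (ae_hasWeakFDerivOn_slice_past hH hT₁)).exists
        have h1 : AEStronglyMeasurable (H τ) volume := by
          have := hτd.locallyIntegrableOn_deriv.aestronglyMeasurable
          rwa [Opens.coe_top, Measure.restrict_univ] at this
        have h2 : AEStronglyMeasurable (fun y => H τ (y + ξ τ)) volume :=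
          h1.comp_quasiMeasurePreserving (measurePreserving_add_right volume (ξ τ)).quasiMeasurePreserving
        have h3 : G₀ =ᵐ[volume] fun y => H τ (y + ξ τ) := by
          have h4 := (measurePreserving_add_right volume (ξ τ)).quasiMeasurePreserving.ae_eq hτ
          filter_upwards [h4] with y hy
          simp only [Function.comp] at hy
          rw [hy, add_sub_cancel_right]
        exact ((ENNReal.continuous_ofReal.comp LerayHopfProofs.continuous_frobeniusNormSq).comp_aestronglyMeasurable
          ((h2.congr h3.symm).restrict)).aemeasurable
      have h0 := (lintegral_eq_zero_iff' hm).1 (setLIntegral_profileGradient_eq_zero hH hT₁ hrep hρ hρ1 hE hK hβρ hξ n)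
      filter_upwards [h0] with y hy
      have h1 : frobeniusNormSq (G₀ y) ≤ 0 := ENNReal.ofReal_eq_zero.1 hy
      have h2 : ‖G₀ y‖ ^ 2 ≤ 0 := (sq_opNorm_le_frobeniusNormSq _).trans h1
      exact norm_eq_zero.1 (by nlinarith [norm_nonneg (G₀ y)])
    have hU : (univ : Set (EuclideanSpace ℝ (Fin 3))) = ⋃ n : ℕ, ball (0 : EuclideanSpace ℝ (Fin 3)) (n : ℝ) := by
      ext y; simp only [mem_univ, mem_iUnion, mem_ball_zero_iff, true_iff]; exact exists_nat_gt ‖y‖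
    have := (ae_restrict_iUnion_iff (μ := (volume : Measure (EuclideanSpace ℝ (Fin 3)))) (s := fun n : ℕ => ball 0 (n : ℝ))
      (p := fun y => G₀ y = 0)).2 hball
    rwa [← hU, Measure.restrict_univ] at this
  -- (3) `H = 0` a.e. below `T₁`
  have hslice0 : ∀ᵐ τ ∂(volume.restrict (Iio T₁)), H τ =ᵐ[volume] 0 := by
    filter_upwards [hrep] with τ hτ
    have h1 := (measurePreserving_sub_right volume (ξ τ)).quasiMeasurePreserving.ae_eq hG0
    exact hτ.trans h1
  have hHm : AEStronglyMeasurable (uncurry H) (volume.restrict (Iio T₁ ×ˢ (univ : Set (EuclideanSpace ℝ (Fin 3))))) := by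
    have h0 := hH.locallyIntegrableOn_grad.aestronglyMeasurable
    rw [coe_slab] at h0
    exact h0.mono_set (Set.prod_mono (Iio_subset_Iio hT₁) Subset.rfl)
  have hH0 := ae_zero_of_ae_slice hHm hslice0
  -- (4) a.e. slice below `T₁` is a.e. constant with zero energy
  have hslice := TypeIliouvilleNoTypeII.PowerGaugeSteady.ae_slice_const_of_weakGradient_ae_zero isOpen_Iio
    (hH.mono (slab_mono (Iio_subset_Iio hT₁))) hH0
  have hzero : ∀ᵐ τ ∂(volume.restrict (Iio T₁)), ∫⁻ x, ‖u τ x‖ₑ ^ 2 = 0 := by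
    filter_upwards [hslice, ae_restrict_mem measurableSet_Iio] with τ hτ hτT
    obtain ⟨b, hb⟩ := hτ
    exact PastPeriodic.lintegral_slice_eq_zero_of_ae_const_of_gaugeA hρ hA (lt_of_lt_of_le hτT hT₁) hb
  exact PastSymmetric.ae_eq_zero_of_gauge_of_pastSlicesZero hρ.le hsw hH hc hzero

end FrameSteady

end Summit.NavierStokesRegularity.NavierStokesRegularity.Theorems.PowerGaugeEulerLiouville
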